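import Literature.AnabelianGeometry.EtaleTheta.SettingModelKrullPiCInv
import Literature.AnabelianGeometry.EtaleTheta.MuTwoSettingPiCData
import HarnessLib

/-!
# The cusped untwisted Krull model, file K5b: the Def. 1.7 layer `MuTwoSetting.inversionModelκ′`, its C-LEVEL DATA,
# and the profinite completion `Π^tp_C ↪ Π_C` onto K4's carrier `PiCκ`

S. Mochizuki, *The étale theta function and its Frobenioid-theoretic manifestations*, Publ. RIMS **45** (2009) [EtTh],
Def. 1.7, PRIMS PDF p. 27 (printed 253): «`X^log → C^log` … the stack-theoretic quotient by ±1», «`ε_μ ∈ Gal(Ẍ/X)`»,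
«`ε_± ∈ Gal(Ẍ/C)`», «a nontrivial element `ε_Z ∈ Gal(Ẍ/X)` which is `≠ ε_μ`»; §2 p. 36 «`Π_X ⊆ Π_C` … `1 → Δ_X → Π_X →
G_K → 1`, `Δ_C := Ker(Π_C ↠ G_K)`»; Prop. 2.4 p. 38 (profinite completions) [cite: MochizukiEtTh2009, Def 1.7 p.27].
Cell abc-iut, layer L2, seat abc-iut-L2-t10 (gen 6), row «COR 2.8 (iii) OUTER-TRANSPORT NV AT THE KRULL CARRIER modelκ′»
(abc-iut-L2-lead R289/R308), file 2 of 3 (K5a `SettingModelKrullPiCInv` → K5b → `Discharge/Sec2OuterTransportModelKrull`).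

Over K5a's tempered carrier `PiCInvκ p = Π^tp_X ⋊_ι ℤ/2` (abc-iut-w5-d140's F8ιc `SettingModelChiMuTwoInversionCusp`
transcribed with `χ ↦ 1`; abc-iut-L2-d3's `CLevelData` / `piCDataOf`, abc-iut-L2-t1's `Semidirect` toolkit BY NAME):
* §3 `augCInvκ : Π^tp_C → G_{ℚ_p}`, `(x, z) ↦ aug x` (`ι` is over `G_K`);
* §4 **`MuTwoSetting.inversionModelκ' p : MuTwoSetting p`** over `ThetaSetting.modelκ' p` (`Π^tp_Ẍ := Xddκ`, `ε_μ := b`,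
  `ε_± := (1, 1̄)`, `ε_Z := a`): `rfl` bookkeeping, guard `IsEtThOrigin`, `Compat`, admissible `ε_Z`, (R1d), the cusp;
* §5 **`cLevelDataInvκ' : (inversionModelκ' p).CLevelData`**; `conjX_epsPMInvκ' : conjX ε_± = twistedInversionTop 1`; (R1e′)
  for it (`hinv_conjX_epsPMInvκ'`, gen 5's `twistedInversion_hinv_modelκ'` of K4);
* §6 JUNCTION WITH K4 — **`toHatCκ : Π^tp_C →ₜ* PiCκ p`**, `(x, z) ↦ (toHat x, z)` (`Semidirect.mapCont`; the two
  `ℤ/2`-actions agree, K5a `toHatκ_invActionκ`), is an injective PROFINITE COMPLETION (`isProfiniteCompletion_toHatCκ`,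
  abc-iut-L2-t1's `isProfiniteCompletion_mapCont`): gen 5's hand-built `Π_C = Π_X ⋊_{ι̂} ℤ/2` IS the completion of this `Π^tp_C`,
  `toHatC ∘ inclX = inl ∘ toHat`, `toHatC ε_± = (1, 1̄)` (K4's `ε`), `augCκ ∘ toHatC = augC`.
File 3 (proof-only) derives hIx ∧ hιell ∧ hιtheta at the DERIVED `Π_C`-bundles `(cLevelDataInvκ' p).piCData` /
`piCDataOf (toHatCκ p)` and the outer automorphism pair of Cor. 2.8 (iii) for every `g ∈ Π^tp_C`.

HONEST LIMITS: SEMI-SYNTHETIC model (untwisted Galois action on `Γ`; not the tempered `π₁` of an orbicurve) — consistency /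
non-vacuity evidence for the typed interface ONLY. Class (b) construction over the FROZEN interfaces `MuTwoSetting` /
`CLevelData` (no interface clause touched; no instance; no `Prop` fact): definitions `augCInvκ`, the term
`MuTwoSetting.inversionModelκ'`, `cLevelDataInvκ'`, `toHatCκ`. Nothing of [EtTh] asserted; no side taken on [IUTchIII]
Cor. 3.12; typed ≠ proved; instantiated ≠ endorsed.
-/

noncomputable section

namespace Literature.AnabelianGeometry.EtaleTheta.SettingModel

open Literature.AnabelianGeometry.SemiGraphs
open _root_.Topology _root_.Function

variable (p : ℕ) [Fact p.Prime]

/-! ## §3. The augmentation `Π^tp_C → G_{ℚ_p}` -/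

/-- **`augC : Π^tp_C → G_{ℚ_p}`, `(x, z) ↦ aug x`** (a homomorphism because `ι` is over `G_K`), continuous. DEFINED.
[cite: MochizukiEtTh2009, Def 1.7 p.27] -/
def augCInvκ : PiCInvκ p →ₜ* GQp p where
  toMonoidHom := Semidirect.leftHom (augκ p).toMonoidHom (augκ_invActionκ p)
  continuous_toFun := (augκ p).continuous.comp (Semidirect.continuous_left (isInducing_leftRightCInvκ p))

/-- [cite: MochizukiEtTh2009, Def 1.7 p.27] -/
theorem augCInvκ_apply (g : PiCInvκ p) : augCInvκ p g = augκ p g.left := rfl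

/-- `augC ∘ inclX = aug`. [cite: MochizukiEtTh2009, Def 1.7 p.27] -/
theorem augCInvκ_inclInvκ (x : PiTpκ p) : augCInvκ p (inclInvκ p x) = augκ p x := by
  rw [augCInvκ_apply, inclInvκ, SemidirectProduct.left_inl]

/-- `augC ε_± = 1` (`ε_±` is geometric). [cite: MochizukiEtTh2009, Def 1.7 p.27] -/
theorem augCInvκ_epsPMInvκ : augCInvκ p (epsPMInvκ p) = 1 := by
  rw [augCInvκ_apply, epsPMInvκ, SemidirectProduct.left_inr, map_one]

/-- `augC` is onto `G_{ℚ_p}`. [cite: MochizukiEtTh2009, Def 1.7 p.27] -/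
theorem range_augCInvκ : (augCInvκ p).toMonoidHom.range = ⊤ :=
  MonoidHom.range_eq_top.mpr fun σ => ⟨inclInvκ p (SemidirectProduct.inr σ), rfl⟩

/-! ## §4. The inhabitant `MuTwoSetting.inversionModelκ′` -/

/-- **The inversion model of [EtTh] Def. 1.7 over the cusped untwisted Krull root**: `Π^tp_C := Π^tp_X ⋊_ι ℤ/2`,
`Π^tp_Ẍ := Xddκ`, `ε_μ := b`, `ε_± := (1, 1̄)` (so that `ε_±`-conjugation on `Π^tp_X` is `twistedInversion 1`), over
`ThetaSetting.modelκ' p` (one cusp on the COMMUTATOR axis). Semi-synthetic; consistency evidence only. DEFINED.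
[cite: MochizukiEtTh2009, Def 1.7 p.27] -/
abbrev _root_.Literature.AnabelianGeometry.EtaleTheta.MuTwoSetting.inversionModelκ' : MuTwoSetting p where
  toThetaSetting := ThetaSetting.modelκ' p
  sqrtqX_mem_K := natCast_mem _ p
  GtpC := PiCInvκ p
  inclX := inclInvκ p
  continuous_inclX := continuous_inclInvκ p
  injective_inclX := SemidirectProduct.inl_injective
  isOpen_range_inclX := isOpen_range_inclInvκ p
  range_inclX_normal := by
    rw [range_inclInvκ]
    infer_instance
  index_range_inclX := by
    rw [range_inclInvκ, Subgroup.index_ker, MonoidHom.range_eq_top.mpr (toGalXCκ_surjective p), Subgroup.card_top]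
    change Nat.card (ZMod 2) = 2
    exact Nat.card_zmod 2
  GtpXdd := Xddκ p
  index_GtpXdd := index_Xddκ p
  map_GtpXdd_normal := map_inclInvκ_Xddκ_normal p
  sq_mem_GtpXdd g := by
    rw [sq_eq_inlκ]
    exact ⟨_, mul_invActionκ_mem_Xddκ p _ _, rfl⟩
  GtpYdd_le_GtpXdd := gtpYdd_modelκ'_le_Xddκ p
  epsMu := inclInvκ p (SemidirectProduct.inl (gfpOf (FreeGroup.of 1)))
  epsMu_mem := ⟨_, rfl⟩
  epsMu_not_mem := by
    rintro ⟨y, hy, hyy⟩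
    have h := SemidirectProduct.inl_injective hyy
    subst h
    exact inl_gfpOf_one_not_mem_Xddκ p hy
  epsPM := epsPMInvκ p
  epsPM_not_mem := epsPMInvκ_not_mem_range p

/-- The model sits over `modelκ′`. [cite: MochizukiEtTh2009, Def 1.7 p.27] -/
theorem _root_.Literature.AnabelianGeometry.EtaleTheta.MuTwoSetting.inversionModelκ'_toThetaSetting :
    (MuTwoSetting.inversionModelκ' p).toThetaSetting = ThetaSetting.modelκ' p := rfl

/-- … hence satisfies the guard `IsEtThOrigin`. [cite: MochizukiEtTh2009, §1 p.12] -/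
theorem _root_.Literature.AnabelianGeometry.EtaleTheta.MuTwoSetting.inversionModelκ'_isEtThOrigin :
    (MuTwoSetting.inversionModelκ' p).toThetaSetting.IsEtThOrigin :=
  ThetaSetting.modelκ'_isEtThOrigin p

/-- … and `Compat`. [cite: MochizukiEtTh2009, Prop 1.5 p.22] -/
theorem _root_.Literature.AnabelianGeometry.EtaleTheta.MuTwoSetting.inversionModelκ'_compat :
    (MuTwoSetting.inversionModelκ' p).toThetaSetting.Compat :=
  (ThetaSetting.modelκ' p).compat

/-- `ε_±` / `inclX` of the model are `epsPMInvκ` / `inclInvκ`. [cite: MochizukiEtTh2009, Def 1.7 p.27] -/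
theorem _root_.Literature.AnabelianGeometry.EtaleTheta.MuTwoSetting.inversionModelκ'_epsPM_inclX :
    (MuTwoSetting.inversionModelκ' p).epsPM = epsPMInvκ p ∧
      ∀ x, (MuTwoSetting.inversionModelκ' p).inclX x = inclInvκ p x :=
  ⟨rfl, fun _ => rfl⟩

/-- **`ε_± · inclX x · ε_±⁻¹ = inclX (ι x)`** at the model. [cite: MochizukiEtTh2009, §2 p.36] -/
theorem _root_.Literature.AnabelianGeometry.EtaleTheta.MuTwoSetting.inversionModelκ'_epsPM_conj (x : PiTpκ p) :
    (MuTwoSetting.inversionModelκ' p).epsPM * (MuTwoSetting.inversionModelκ' p).inclX x *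
        (MuTwoSetting.inversionModelκ' p).epsPM⁻¹ =
      (MuTwoSetting.inversionModelκ' p).inclX (twistedInversionTop (1 : GQp p →* MulAut ZH) (isInducing_leftRightκ p) x) :=
  epsPM_conj_inlκ p x

/-- **`ε_Z := a` is admissible** (`a ∉ Π^tp_Ẍ`, `a·b⁻¹ ∉ Π^tp_Ẍ`). [cite: MochizukiEtTh2009, Def 1.7 p.27] -/
theorem _root_.Literature.AnabelianGeometry.EtaleTheta.MuTwoSetting.inversionModelκ'_isAdmissibleEpsZ :
    (MuTwoSetting.inversionModelκ' p).IsAdmissibleEpsZ (epsZInvκ p) := by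
  refine ⟨⟨_, rfl⟩, ?_, ?_⟩
  · rintro ⟨y, hy, hyy⟩
    have h := SemidirectProduct.inl_injective hyy
    subst h
    exact inl_gfpOf_zero_not_mem_Xddκ p hy
  · change inclInvκ p (SemidirectProduct.inl (gfpOf (FreeGroup.of 0))) *
        (inclInvκ p (SemidirectProduct.inl (gfpOf (FreeGroup.of 1))))⁻¹ ∉ (Xddκ p).map (inclInvκ p)
    rw [← map_inv, ← map_mul]
    rintro ⟨y, hy, hyy⟩
    have h := SemidirectProduct.inl_injective hyy
    subst h
    exact inl_gfpOf_zero_mul_inv_not_mem_Xddκ p hy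

/-- **(R1d)**: `inclX` induces the topology of `Π^tp_X`. [cite: MochizukiEtTh2009, Def 1.7 p.27] -/
theorem _root_.Literature.AnabelianGeometry.EtaleTheta.MuTwoSetting.isInducing_inclX_inversionModelκ' :
    IsInducing (MuTwoSetting.inversionModelκ' p).inclX :=
  isInducing_inclInvκ p

/-- **The model has a cusp** (K3b's commutator-axis cusp of `curveκ′`). [cite: MochizukiEtTh2009, §1 p.13] -/
theorem _root_.Literature.AnabelianGeometry.EtaleTheta.MuTwoSetting.exists_isCusp_inversionModelκ' :
    ∃ x : (MuTwoSetting.inversionModelκ' p).Pt, (MuTwoSetting.inversionModelκ' p).IsCusp x :=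
  ⟨(), trivial⟩

/-! ## §5. C-level data and the `ε_±`-conjugation -/

/-- **C-level data for `MuTwoSetting.inversionModelκ′`** (abc-iut-L2-d3's `CLevelData`): `inclX` an open embedding,
`augC := aug ∘ left` of range `G_K = G_{ℚ_p}`. DEFINED. [cite: MochizukiEtTh2009, Def 1.7 p.27] -/
def cLevelDataInvκ' : (MuTwoSetting.inversionModelκ' p).CLevelData where
  isOpenEmbedding_inclX := isOpenEmbedding_inclInvκ p
  augC := augCInvκ p
  augC_inclX := augCInvκ_inclInvκ p
  range_augC := by
    rw [range_augCInvκ]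
    exact (IntermediateField.fixingSubgroup_bot (F := ℚ_[p]) (E := PadicAlgCl p)).symm

/-- Census: `CLevelData` is inhabited over the cusped untwisted Krull model. [cite: MochizukiEtTh2009, Def 1.7 p.27] -/
theorem nonempty_cLevelData_inversionModelκ' : Nonempty (MuTwoSetting.inversionModelκ' p).CLevelData :=
  ⟨cLevelDataInvκ' p⟩

/-- **The `CLevelData` inner automorphism of `Π^tp_X` by `ε_±` IS `twistedInversionTop 1`.** [cite: MochizukiEtTh2009, §2 p.36] -/
theorem conjX_epsPMInvκ' :
    (cLevelDataInvκ' p).conjX (epsPMInvκ p) = twistedInversionTop (1 : GQp p →* MulAut ZH) (isInducing_leftRightκ p) := by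
  refine ContinuousMulEquiv.ext fun x => (MuTwoSetting.inversionModelκ' p).injective_inclX ?_
  have h := (cLevelDataInvκ' p).inclX_conjX (epsPMInvκ p) x
  change inclInvκ p _ = epsPMInvκ p * inclInvκ p x * (epsPMInvκ p)⁻¹ at h
  rw [epsPM_conj_inlκ] at h
  exact h

/-- **(R1e′) for the `ε_±`-conjugation of the C-level data**: `ε̂_± y · y ∈ ⁅Δ̂_X, Δ̂_X⁆⁻` for every `y ∈ Δ̂_X`
(gen 5's `twistedInversion_hinv_modelκ'`, K4). [cite: MochizukiEtTh2009, Prop 2.2 (i) p.37] -/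
theorem hinv_conjX_epsPMInvκ' :
    ∀ y ∈ (MuTwoSetting.inversionModelκ' p).DeltaHat,
      (MuTwoSetting.inversionModelκ' p).completionAut ((cLevelDataInvκ' p).conjX (epsPMInvκ p)) y * y ∈
        (⁅(MuTwoSetting.inversionModelκ' p).DeltaHat, (MuTwoSetting.inversionModelκ' p).DeltaHat⁆).topologicalClosure := by
  rw [conjX_epsPMInvκ']
  exact twistedInversion_hinv_modelκ' p

/-! ## §6. Junction with K4: `Π^tp_C ↪ Π_C := PiCκ` is a profinite completion -/

/-- **`toHatC : Π^tp_C = Π^tp_X ⋊_ι ℤ/2 → Π_C = Π_X ⋊_{ι̂} ℤ/2`**, `(x, z) ↦ (toHat x, z)` — abc-iut-L2-t1's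
`Semidirect.mapCont` at `toHatκ`, the two `ℤ/2`-actions being compatible (`toHatκ_invActionκ`). DEFINED.
[cite: MochizukiEtTh2009, Prop 2.4 p.38] -/
def toHatCκ : PiCInvκ p →ₜ* PiCκ p :=
  Semidirect.mapCont (isInducing_leftRightCInvκ p) (isInducing_leftRightCκ p) (toHatκ p) (toHatκ_invActionκ p)

/-- [cite: MochizukiEtTh2009, Prop 2.4 p.38] -/
@[simp] theorem toHatCκ_left (g : PiCInvκ p) : (toHatCκ p g).left = toHatκ p g.left := rfl

/-- [cite: MochizukiEtTh2009, Prop 2.4 p.38] -/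
@[simp] theorem toHatCκ_right (g : PiCInvκ p) : (toHatCκ p g).right = g.right := rfl

/-- `toHatC ∘ inclX = inl ∘ toHat` (= K4's `piCDataκ'.incl ∘ toHat`). [cite: MochizukiEtTh2009, Prop 2.4 p.38] -/
theorem toHatCκ_inclInvκ (x : PiTpκ p) : toHatCκ p (inclInvκ p x) = SemidirectProduct.inl (toHatκ p x) :=
  SemidirectProduct.ext rfl rfl

/-- `toHatC ε_± = (1, 1̄)` (K4's `ε`). [cite: MochizukiEtTh2009, §2 p.36] -/
theorem toHatCκ_epsPMInvκ : toHatCκ p (epsPMInvκ p) = SemidirectProduct.inr (Multiplicative.ofAdd 1) :=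
  SemidirectProduct.ext (map_one (toHatκ p)) rfl

/-- `Π^tp_C ↪ Π_C` is injective. [cite: MochizukiEtTh2009, Prop 2.4 p.38] -/
theorem toHatCκ_injective : Injective (toHatCκ p) :=
  Semidirect.mapCont_injective _ _ _ _ (toHatκ_injective p)

/-- **`Π_C = (Π^tp_C)^∧`**: `toHatC` is a PROFINITE COMPLETION (abc-iut-L2-t1's `isProfiniteCompletion_mapCont` at K1b's
`isProfiniteCompletion_toHatκ`; each `φ̂(z) ∈ {1, ι̂}` is continuous). [cite: MochizukiEtTh2009, Prop 2.4 p.38] -/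
theorem isProfiniteCompletion_toHatCκ : IsProfiniteCompletion (toHatCκ p) :=
  Semidirect.isProfiniteCompletion_mapCont (isInducing_leftRightCInvκ p) (isInducing_leftRightCκ p) (toHatκ p)
    (toHatκ_invActionκ p) (isProfiniteCompletion_toHatκ p) (fun z => by
      rcases hatInvActionκ_eq_one_or p z with h | h <;> rw [h]
      · exact continuous_id
      · exact continuous_hatInvκ p)

/-- `augC` of K4's carrier extends `augC` of the tempered one: `augCκ (toHatC g) = augCInvκ g`.
[cite: MochizukiEtTh2009, Def 2.1 p.36] -/
theorem augCκ_toHatCκ (g : PiCInvκ p) : augCκ p (toHatCκ p g) = augCInvκ p g := by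
  rw [augCκ_apply, toHatCκ_left, augCInvκ_apply]
  exact augHatκ_toHatκ p g.left

end Literature.AnabelianGeometry.EtaleTheta.SettingModel

end
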